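import Literature.NumberTheory.Sieve.BrunPureSieve
import Literature.NumberTheory.Sieve.SingularSeries
import Mathlib.Data.Int.CardIntervalMod
import Mathlib.NumberTheory.Primorial
import HarnessLib

/-!
# Gallagher's theorem: the singular series averages to 1 over cubes

Trunk: NumberTheory / Sieve (Hardy–Littlewood singular series; input (3.7) of
Goldston–Pintz–Yıldırım, *Primes in tuples I*, §3).

P. X. Gallagher, *On the distribution of primes in short intervals*, Mathematika **23** (1976), 4–9,
eq. (3), p. 5: for each `r ≥ 1`,

  `∑_{1 ≤ d₁, …, d_r ≤ h, dᵢ distinct} 𝔖({d₁, …, d_r}) ∼ h^r`  (`h → ∞`),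

where `𝔖(H) = ∏_p (1 − ν_H(p)/p)(1 − 1/p)^{−r}` is the Hardy–Littlewood singular series
(`Literature.NumberTheory.Sieve.singularSeries`, an ordered limit of the partial products `Literature.NumberTheory.Sieve.singularSeriesPartial`).

## Main result

* `Literature.NumberTheory.Sieve.Gallagher.tendsto_sum_singularSeries_div_pow` — Gallagher's (3), PROVED: for every `k`,
  `(∑_{t : Fin k → [1, h] injective} 𝔖(tupleSet t)) / h^k → 1`; the sum is over ordered tuples of
  distinct integers, exactly as in (3) and in GPY (3.7). It is definitionally the body of the named
  fact `Literature.NumberTheory.Sieve.GPY.gallagher_sum_singularSeries`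
  (`Literature.NumberTheory.Sieve.GoldstonPintzYildirim`), whose discharge
  `Literature.NumberTheory.Sieve.GPY.gallagher_sum_singularSeries_holds` is the sibling proof file
  `Literature/NumberTheory/Sieve/GoldstonPintzYildirimProofs.lean` (that file imports this one; the
  dependency runs GPY §3 → Gallagher, not conversely).

## Proof

Gallagher (§2, pp. 6–8) expands `𝔖_d = ∑_q a_d(q)` over squarefree `q` and counts tuples by residue
pattern with the Chinese remainder theorem, the main term coming from the vanishing `A(q) = 0`
(`q > 1`) of the average of `a_d(q)`. The proof here is an elementary variant on the product side,
built on the fact that the Euler factor at `p` averages to exactly `1` over `(ℤ/p)^k`: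

1. *Local identity* (`sum_localFactor_range`): `∑_{x ∈ [0,p)^k} (1 − ν_p(x)/p)(1 − 1/p)^{−k} = p^k`,
   from `∑_x (p − ν_p(x)) = p (p − 1)^k` (count pairs `(x, c)` with `c ∉ im x`).
2. *Independence* (`sum_prod_localFactor`, CRT by induction on the set of primes): the truncated
   product `truncProd k y t = ∏_{p ≤ y} (…)` summed over one period `[0, P)^k`, `P = ∏_{p ≤ y} p`,
   is exactly `P^k`; hence over `m` periods `(mP)^k` (`sum_truncProd_box`), and over the cube
   `[1, h]^k` it is squeezed between `(⌊h/P⌋ P)^k` and `((⌊h/P⌋ + 1) P)^k`.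
3. *Tail* (`singularSeries_tupleSet_bounds`, Gallagher's bounds (7)): for `y ≥ k²` and an injective
   `t ∈ [1, h]^k`, `1 − 2k²/y ≤ 𝔖(t) / truncProd ≤ exp((2k/y) · k² log h / log y)`, since the primes
   `p > y` with `ν_p(t) < k` divide `∏_{i<j} |tᵢ − tⱼ|` (at most `k² log h / log y` of them).
4. *Assembly*: non-injective tuples are `≤ k² h^{k−1}` and `truncProd ≤ y^k`; with `y = ⌊log₁₆ h⌋`,
   `P ≤ 4^y ≤ √h`, both bounds divided by `h^k` are functions of `y` alone tending to `1`.

Design: tuples are `t : Fin k → ℕ` in the cube `Fintype.piFinset fun _ => Finset.Icc 1 h`, distinct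
tuples are the injective ones, residues are computed in `ℕ` (`t j % p`) and bridged to
`Literature.NumberTheory.Sieve.tupleResidueCount` through `ZMod.val`; no analytic input beyond
`Literature.NumberTheory.Sieve.SingularSeries` (convergence of the Euler product); Weierstrass's
inequality `1 − ∑ aᵢ ≤ ∏ (1 − aᵢ)` is taken from `Literature.NumberTheory.Sieve.BrunPureSieve`
(Bonferroni at `r = 0`).

## References

* P. X. Gallagher, *On the distribution of primes in short intervals*, Mathematika 23 (1976), 4–9,
  doi:10.1112/S0025579300016442; eq. (3) p. 5, §2 pp. 6–8 (eqs. (6)–(10)). [cite: Gallagher1976]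
* D. A. Goldston, J. Pintz, C. Y. Yıldırım, *Primes in tuples. I*, Ann. of Math. (2) 170 (2009),
  819–862 (arXiv:math/0508185, eq. (3.7) p. 8). [cite: GoldstonPintzYildirim2009]
-/

noncomputable section

open Filter Finset Real
open scoped Topology

namespace Literature.NumberTheory.Sieve.Gallagher

/-! ### The objects -/

/-- `ν_p(t)`: the number of distinct residue classes modulo `p` occupied by the entries of the
tuple `t = (t₀, …, t_{k−1})` (Gallagher's `ν_d(p)`, p. 4; here on ordered tuples of naturals, via
`t j % p`). [cite: Gallagher1976, Section 2 p. 6] -/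
def resCount {k : ℕ} (p : ℕ) (t : Fin k → ℕ) : ℕ := #(univ.image fun j => t j % p)

/-- The `p`-th Euler factor `(1 − ν_p(t)/p)(1 − 1/p)^{−k}` of the singular series of a `k`-tuple
(Gallagher p. 4 and (6), p. 6); agrees with `Literature.NumberTheory.Sieve.singularSeriesFactor` of the tuple's value set when
`t` is injective (`singularSeriesPartial_tupleSet`). [cite: Gallagher1976, eq. 6] -/
def localFactor (k p : ℕ) (t : Fin k → ℕ) : ℝ :=
  (1 - (resCount p t : ℝ) / p) * (1 - 1 / (p : ℝ))⁻¹ ^ k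

/-- The Euler product of the singular series truncated at `y`:
`∏_{p ≤ y} (1 − ν_p(t)/p)(1 − 1/p)^{−k}`. It depends on `t` only modulo the primorial
`∏_{p ≤ y} p`, which is what makes its average over cubes exactly computable (the device of
this file's proof; Gallagher instead expands `𝔖` into the series (8)). [folklore] -/
def truncProd (k y : ℕ) (t : Fin k → ℕ) : ℝ := ∏ p ∈ Nat.primesLE y, localFactor k p t

/-- Componentwise reduction of a tuple modulo `n`: `(t mod n)_j = t_j % n`. [folklore] -/
def modVec {k : ℕ} (n : ℕ) (t : Fin k → ℕ) : Fin k → ℕ := fun j => t j % n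

/-- The value set `{t₀, …, t_{k−1}} ⊆ ℤ` of a tuple of naturals, the argument of
`Literature.NumberTheory.Sieve.singularSeries`. [folklore] -/
def tupleSet {k : ℕ} (t : Fin k → ℕ) : Finset ℤ := univ.image fun j => (t j : ℤ)

/-- Unfolding lemma for `modVec`. [folklore] -/
theorem modVec_apply {k : ℕ} (n : ℕ) (t : Fin k → ℕ) (j : Fin k) : modVec n t j = t j % n := rfl

/-- `ν_p(t) ≤ k` (Gallagher p. 6: `1 ≤ ν_d(p) ≤ r`). [cite: Gallagher1976, Section 2 p. 6] -/
theorem resCount_le {k : ℕ} (p : ℕ) (t : Fin k → ℕ) : resCount p t ≤ k := by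
  unfold resCount
  exact Finset.card_image_le.trans (by simp)

/-- `ν_p(t) ≤ p`: there are only `p` residue classes. [folklore] -/
theorem resCount_le_self {k : ℕ} {p : ℕ} (hp : 0 < p) (t : Fin k → ℕ) : resCount p t ≤ p := by
  unfold resCount
  calc #(univ.image fun j => t j % p) ≤ #(range p) :=
        Finset.card_le_card (fun x hx => by
          obtain ⟨j, -, rfl⟩ := Finset.mem_image.1 hx
          exact Finset.mem_range.2 (Nat.mod_lt _ hp))
    _ = p := Finset.card_range p

/-- Each Euler factor is nonnegative (`ν_p(t) ≤ p`). [folklore] -/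
theorem localFactor_nonneg (k : ℕ) {p : ℕ} (hp : 0 < p) (t : Fin k → ℕ) :
    0 ≤ localFactor k p t := by
  unfold localFactor
  have hp' : (0 : ℝ) < p := by exact_mod_cast hp
  have h1 : (resCount p t : ℝ) ≤ p := by exact_mod_cast resCount_le_self hp t
  refine mul_nonneg ?_ (pow_nonneg (inv_nonneg.2 ?_) _)
  · rw [sub_nonneg, div_le_one hp']; exact h1
  · rw [sub_nonneg, div_le_one hp']; exact_mod_cast hp

/-- The truncated product is nonnegative. [folklore] -/
theorem truncProd_nonneg (k y : ℕ) (t : Fin k → ℕ) : 0 ≤ truncProd k y t :=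
  Finset.prod_nonneg fun _ hp => localFactor_nonneg k (Nat.mem_primesLE.1 hp).2.pos t

/-- Bridge to `Literature.NumberTheory.Sieve.tupleResidueCount`: `ν_p` of the value set of `t` is `resCount p t`
(`ZMod.val` is injective and `(t_j : ZMod p).val = t_j % p`). [folklore] -/
theorem tupleResidueCount_tupleSet {k : ℕ} {p : ℕ} (hp : p.Prime) (t : Fin k → ℕ) :
    tupleResidueCount (tupleSet t) p = resCount p t := by
  haveI := NeZero.mk hp.ne_zero
  unfold tupleResidueCount tupleSet resCount
  rw [Finset.image_image]
  have : (univ.image fun j => t j % p) =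
      (univ.image ((fun h : ℤ => (h : ZMod p)) ∘ fun j => (t j : ℤ))).image ZMod.val := by
    rw [Finset.image_image]
    refine Finset.image_congr ?_
    intro j _
    simp [Function.comp, ZMod.val_natCast]
  rw [this, Finset.card_image_of_injective _ (ZMod.val_injective p)]

/-- An injective `k`-tuple has a value set of size `k`. [folklore] -/
theorem card_tupleSet {k : ℕ} {t : Fin k → ℕ} (ht : Function.Injective t) : #(tupleSet t) = k := by
  unfold tupleSet
  rw [Finset.card_image_of_injective, Finset.card_univ, Fintype.card_fin]
  intro i j hij
  have hij' : (t i : ℤ) = t j := hij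
  exact ht (by exact_mod_cast hij')

/-- Bridge to `Literature.NumberTheory.Sieve.singularSeriesPartial`: for injective `t` the partial product of the singular
series of its value set is `truncProd`. [folklore] -/
theorem singularSeriesPartial_tupleSet {k : ℕ} {t : Fin k → ℕ} (ht : Function.Injective t)
    (y : ℕ) : singularSeriesPartial (tupleSet t) y = truncProd k y t := by
  unfold singularSeriesPartial truncProd
  refine Finset.prod_congr rfl fun p hp => ?_
  have hp' := (Nat.mem_primesLE.1 hp).2
  unfold singularSeriesFactor localFactor
  rw [tupleResidueCount_tupleSet hp', card_tupleSet ht]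

/-- `∏_{p ≤ y} (1 − 1/p)^{−1} ≤ y` for `y ≥ 1`: compare with the telescoping product over all
`2 ≤ n ≤ y`. [folklore] -/
theorem prod_primesLE_inv_le (y : ℕ) (hy : 1 ≤ y) :
    ∏ p ∈ Nat.primesLE y, (1 - 1 / (p : ℝ))⁻¹ ≤ y := by
  -- compare with the product over all `n ∈ [2, y]`, which telescopes to `y`
  have htel : ∀ m : ℕ, ∏ n ∈ Icc 2 (m + 1), (1 - 1 / (n : ℝ))⁻¹ = m + 1 := by
    intro m
    induction m with
    | zero => simp
    | succ m ih =>
      rw [Finset.prod_Icc_succ_top (by omega), ih]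
      push_cast
      have hm : (m : ℝ) + 1 + 1 ≠ 0 := by positivity
      have hm1 : (m : ℝ) + 1 ≠ 0 := by positivity
      have e : (1 - 1 / ((m : ℝ) + 1 + 1))⁻¹ = ((m : ℝ) + 1 + 1) / ((m : ℝ) + 1) := by
        field_simp
        ring
      rw [e]
      field_simp
  obtain ⟨m, rfl⟩ : ∃ m, y = m + 1 := ⟨y - 1, by omega⟩
  calc ∏ p ∈ Nat.primesLE (m + 1), (1 - 1 / (p : ℝ))⁻¹
      ≤ ∏ n ∈ Icc 2 (m + 1), (1 - 1 / (n : ℝ))⁻¹ := by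
        apply Finset.prod_le_prod_of_subset_of_one_le
        · intro p hp
          have := Nat.mem_primesLE.1 hp
          exact Finset.mem_Icc.2 ⟨this.2.two_le, this.1⟩
        · intro p hp
          have hp' := (Nat.mem_primesLE.1 hp).2
          have hp0 : (0 : ℝ) < p := by exact_mod_cast hp'.pos
          rw [inv_nonneg, sub_nonneg, div_le_one hp0]; exact_mod_cast hp'.one_le
        · intro n hn _
          have hn2 : (2 : ℝ) ≤ n := by exact_mod_cast (Finset.mem_Icc.1 hn).1
          rw [one_le_inv_iff₀]
          constructor
          · rw [sub_pos, div_lt_one (by linarith)]; linarith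
          · rw [sub_le_self_iff]; positivity
    _ = m + 1 := htel m
    _ = ((m + 1 : ℕ) : ℝ) := by push_cast; ring

/-- Crude bound `truncProd k y t ≤ y^k` (each factor `1 − ν/p ≤ 1`). [folklore] -/
theorem truncProd_le_pow (k y : ℕ) (hy : 1 ≤ y) (t : Fin k → ℕ) :
    truncProd k y t ≤ (y : ℝ) ^ k := by
  unfold truncProd localFactor
  calc ∏ p ∈ Nat.primesLE y, (1 - (resCount p t : ℝ) / p) * (1 - 1 / (p : ℝ))⁻¹ ^ k
      ≤ ∏ p ∈ Nat.primesLE y, (1 - 1 / (p : ℝ))⁻¹ ^ k := by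
        apply Finset.prod_le_prod
        · intro p hp; exact localFactor_nonneg k (Nat.mem_primesLE.1 hp).2.pos t
        · intro p hp
          have hp' := (Nat.mem_primesLE.1 hp).2
          have hp0 : (0 : ℝ) < p := by exact_mod_cast hp'.pos
          have h1 : 0 ≤ (1 - 1 / (p : ℝ))⁻¹ ^ k := by
            apply pow_nonneg; rw [inv_nonneg, sub_nonneg, div_le_one hp0]; exact_mod_cast hp'.one_le
          have h2 : (1 - (resCount p t : ℝ) / p) ≤ 1 := by
            rw [sub_le_self_iff]; positivity
          nlinarith
    _ = (∏ p ∈ Nat.primesLE y, (1 - 1 / (p : ℝ))⁻¹) ^ k := Finset.prod_pow _ _ _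
    _ ≤ (y : ℝ) ^ k := by
        apply pow_le_pow_left₀ _ (prod_primesLE_inv_le y hy)
        apply Finset.prod_nonneg
        intro p hp
        have hp' := (Nat.mem_primesLE.1 hp).2
        have hp0 : (0 : ℝ) < p := by exact_mod_cast hp'.pos
        rw [inv_nonneg, sub_nonneg, div_le_one hp0]; exact_mod_cast hp'.one_le


/-- If `ν_p(t) < k`, two distinct indices carry entries congruent modulo `p`. [folklore] -/
theorem exists_pair_of_resCount_lt {k p : ℕ} {t : Fin k → ℕ} (h : resCount p t < k) :
    ∃ i j : Fin k, i ≠ j ∧ t i % p = t j % p := by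
  by_contra hcon
  push Not at hcon
  have hinj : Function.Injective fun j => t j % p := by
    intro i j hij
    by_contra hne
    exact hcon i j hne hij
  unfold resCount at h
  rw [Finset.card_image_of_injective _ hinj, Finset.card_univ, Fintype.card_fin] at h
  exact lt_irrefl _ h

/-- `1 + 1/p ≤ (1 − 1/p)^{−1} ≤ exp(2/p)` for `p ≥ 2`. [folklore] -/
theorem inv_one_sub_bounds {p : ℝ} (hp : 2 ≤ p) :
    1 + 1 / p ≤ (1 - 1 / p)⁻¹ ∧ (1 - 1 / p)⁻¹ ≤ Real.exp (2 / p) := by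
  have hp0 : 0 < p := by linarith
  have hp1 : 0 < p - 1 := by linarith
  have e : (1 - 1 / p)⁻¹ = 1 + 1 / (p - 1) := by field_simp; ring
  rw [e]
  constructor
  · have : 1 / p ≤ 1 / (p - 1) := one_div_le_one_div_of_le hp1 (by linarith)
    linarith
  · have h1 : 1 / (p - 1) ≤ 2 / p := by
      rw [div_le_div_iff₀ hp1 hp0]; linarith
    calc 1 + 1 / (p - 1) ≤ 1 + 2 / p := by linarith
      _ ≤ Real.exp (2 / p) := by
          have := Real.add_one_le_exp (2 / p); linarith

/-- Generic primes (Gallagher (7), case `ν = r`: `a(p, r) ≪ (p − 1)^{−2}`): if `ν_p(t) = k < p` then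
`1 − k²/p² ≤ (1 − k/p)(1 − 1/p)^{−k} ≤ 1`. [cite: Gallagher1976, eq. 7] -/
theorem localFactor_bounds_of_eq {k p : ℕ} (hp : p.Prime) (hpk : k < p) {t : Fin k → ℕ}
    (hν : resCount p t = k) :
    1 - (k : ℝ) ^ 2 / (p : ℝ) ^ 2 ≤ localFactor k p t ∧ localFactor k p t ≤ 1 := by
  unfold localFactor
  rw [hν]
  have hp2 : (2 : ℝ) ≤ p := by exact_mod_cast hp.two_le
  have hp0 : (0 : ℝ) < p := by linarith
  have hkp : (k : ℝ) < p := by exact_mod_cast hpk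
  obtain ⟨hl, -⟩ := inv_one_sub_bounds hp2
  have hu0 : 0 ≤ (1 - 1 / (p : ℝ))⁻¹ := by
    rw [inv_nonneg, sub_nonneg, div_le_one hp0]; linarith
  have h1k : 0 ≤ 1 - (k : ℝ) / p := by rw [sub_nonneg, div_le_one hp0]; exact hkp.le
  constructor
  · -- lower: u^k ≥ (1 + 1/p)^k ≥ 1 + k/p
    have hb : 1 + (k : ℝ) * (1 / p) ≤ (1 + 1 / (p : ℝ)) ^ k :=
      one_add_mul_le_pow (by have : (0 : ℝ) ≤ 1 / p := by positivity
                             linarith) k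
    have hu : (1 + 1 / (p : ℝ)) ^ k ≤ (1 - 1 / (p : ℝ))⁻¹ ^ k :=
      pow_le_pow_left₀ (by positivity) hl k
    calc 1 - (k : ℝ) ^ 2 / (p : ℝ) ^ 2 = (1 - (k : ℝ) / p) * (1 + k * (1 / p)) := by
          field_simp; ring
      _ ≤ (1 - (k : ℝ) / p) * (1 - 1 / (p : ℝ))⁻¹ ^ k :=
          mul_le_mul_of_nonneg_left (hb.trans hu) h1k
  · -- upper: (1 − k/p) ≤ (1 − 1/p)^k
    have hb : 1 + (k : ℝ) * (-(1 / p)) ≤ (1 + -(1 / (p : ℝ))) ^ k :=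
      one_add_mul_le_pow (by
        have : 1 / (p : ℝ) ≤ 1 := by rw [div_le_one hp0]; linarith
        linarith) k
    have hq : 0 < 1 - 1 / (p : ℝ) := by rw [sub_pos, div_lt_one hp0]; linarith
    calc (1 - (k : ℝ) / p) * (1 - 1 / (p : ℝ))⁻¹ ^ k
        ≤ (1 - 1 / (p : ℝ)) ^ k * (1 - 1 / (p : ℝ))⁻¹ ^ k := by
          apply mul_le_mul_of_nonneg_right _ (pow_nonneg hu0 k)
          have e1 : (1 : ℝ) - k / p = 1 + k * (-(1 / p)) := by ring
          have e2 : (1 : ℝ) - 1 / p = 1 + -(1 / p) := by ring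
          rw [e1, e2]; exact hb
      _ = 1 := by rw [← mul_pow, mul_inv_cancel₀ hq.ne', one_pow]

/-- Exceptional primes (Gallagher (7), case `ν < r`: `a(p, ν) ≪ (p − 1)^{−1}`): if `ν_p(t) < k` and
`p ≥ k²` then `1 ≤ (1 − ν_p(t)/p)(1 − 1/p)^{−k} ≤ exp(2k/p)`. [cite: Gallagher1976, eq. 7] -/
theorem localFactor_bounds_of_lt {k p : ℕ} (hp : p.Prime) (hpk : k * k ≤ p) {t : Fin k → ℕ}
    (hν : resCount p t < k) :
    1 ≤ localFactor k p t ∧ localFactor k p t ≤ Real.exp (2 * k / p) := by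
  unfold localFactor
  have hp2 : (2 : ℝ) ≤ p := by exact_mod_cast hp.two_le
  have hp0 : (0 : ℝ) < p := by linarith
  obtain ⟨hl, hu⟩ := inv_one_sub_bounds hp2
  have hu0 : 0 ≤ (1 - 1 / (p : ℝ))⁻¹ := by
    rw [inv_nonneg, sub_nonneg, div_le_one hp0]; linarith
  have hν' : (resCount p t : ℝ) ≤ (k : ℝ) - 1 := by
    have : resCount p t + 1 ≤ k := hν
    have : ((resCount p t + 1 : ℕ) : ℝ) ≤ k := by exact_mod_cast this
    push_cast at this; linarith
  have hkk : (k : ℝ) * k ≤ p := by exact_mod_cast hpk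
  have hk1 : 1 ≤ k := by omega
  have hk1' : (1 : ℝ) ≤ k := by exact_mod_cast hk1
  have h1ν : 0 ≤ 1 - (resCount p t : ℝ) / p := by
    rw [sub_nonneg, div_le_one hp0]
    have : (k : ℝ) ≤ p := by nlinarith
    linarith
  constructor
  · -- lower: (1 − (k−1)/p)(1 + k/p) ≥ 1 when p ≥ k(k−1)
    have hb : 1 + (k : ℝ) * (1 / p) ≤ (1 + 1 / (p : ℝ)) ^ k :=
      one_add_mul_le_pow (by have : (0 : ℝ) ≤ 1 / p := by positivity
                             linarith) k
    have hupow : (1 + 1 / (p : ℝ)) ^ k ≤ (1 - 1 / (p : ℝ))⁻¹ ^ k :=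
      pow_le_pow_left₀ (by positivity) hl k
    have hA : 1 - ((k : ℝ) - 1) / p ≤ 1 - (resCount p t : ℝ) / p := by
      have := div_le_div_of_nonneg_right hν' hp0.le
      linarith
    have hB : 0 ≤ 1 - ((k : ℝ) - 1) / p := by
      rw [sub_nonneg, div_le_one hp0]; nlinarith
    calc (1 : ℝ) ≤ (1 - ((k : ℝ) - 1) / p) * (1 + k * (1 / p)) := by
          rw [← sub_nonneg]
          have e : (1 - ((k : ℝ) - 1) / p) * (1 + k * (1 / p)) - 1 =
              (p - k * (k - 1)) / (p * p) := by field_simp; ring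
          rw [e]; apply div_nonneg _ (by positivity); nlinarith
      _ ≤ (1 - (resCount p t : ℝ) / p) * (1 - 1 / (p : ℝ))⁻¹ ^ k := by
          apply mul_le_mul hA (hb.trans hupow) (by positivity) h1ν
  · -- upper: ≤ u^k ≤ exp(2/p)^k = exp(2k/p)
    calc (1 - (resCount p t : ℝ) / p) * (1 - 1 / (p : ℝ))⁻¹ ^ k
        ≤ 1 * (1 - 1 / (p : ℝ))⁻¹ ^ k := by
          apply mul_le_mul_of_nonneg_right _ (pow_nonneg hu0 k)
          rw [sub_le_self_iff]; positivity
      _ ≤ Real.exp (2 / p) ^ k := by rw [one_mul]; exact pow_le_pow_left₀ hu0 hu k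
      _ = Real.exp (2 * k / p) := by rw [← Real.exp_nat_mul]; ring_nf


/-- A set of primes `> y ≥ 2` all dividing some `0 < d ≤ h` has at most `log h / log y` elements
(their product divides `d`). [folklore] -/
theorem card_primes_dvd_le {d h y : ℕ} (hd : 0 < d) (hdh : d ≤ h) (hy : 2 ≤ y) (s : Finset ℕ)
    (hs : ∀ p ∈ s, p.Prime ∧ y < p ∧ p ∣ d) : (#s : ℝ) ≤ Real.log h / Real.log y := by
  have hprod : ∏ p ∈ s, p ∣ d :=
    Finset.prod_primes_dvd d (fun p hp => (hs p hp).1.prime) (fun p hp => (hs p hp).2.2)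
  have hle : ∏ p ∈ s, p ≤ h := (Nat.le_of_dvd hd hprod).trans hdh
  have hpow : y ^ #s ≤ ∏ p ∈ s, p :=
    Finset.pow_card_le_prod s (fun p => p) y (fun p hp => (hs p hp).2.1.le)
  have hyh : (y : ℝ) ^ #s ≤ h := by exact_mod_cast hpow.trans hle
  have hy1 : (1 : ℝ) < y := by exact_mod_cast (by omega : 1 < y)
  have hlogy : 0 < Real.log y := Real.log_pos hy1
  rw [le_div_iff₀ hlogy, ← Real.log_pow]
  have hh : (0 : ℝ) < (y : ℝ) ^ #s := by positivity
  exact Real.log_le_log hh hyh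

/-- For an injective tuple in `[1, h]^k`, the primes `p > y` with `ν_p(t) < k` divide
`D = ∏_{i<j} |t_i − t_j|` (Gallagher p. 6: `ν_d(p) = r` unless `p ∣ D_d`), so there are at most
`k² log h / log y` of them in any set of primes `> y`. [cite: Gallagher1976, Section 2 p. 6] -/
theorem card_filter_resCount_lt_le {k h y : ℕ} (hy : 2 ≤ y) {t : Fin k → ℕ}
    (ht : Function.Injective t) (hth : ∀ j, t j ∈ Icc 1 h) (PR : Finset ℕ)
    (hPR : ∀ p ∈ PR, p.Prime ∧ y < p) :
    (#(PR.filter fun p => resCount p t < k) : ℝ) ≤ (k : ℝ) ^ 2 * (Real.log h / Real.log y) := by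
  classical
  -- cover the bad primes by the primes dividing `|t i − t j|`, over ordered pairs `i ≠ j`
  set pairs := (univ : Finset (Fin k × Fin k)).filter fun ij => ij.1 ≠ ij.2 with hpairs
  have hcover : (PR.filter fun p => resCount p t < k) ⊆
      pairs.biUnion fun ij => PR.filter fun p => t ij.1 % p = t ij.2 % p := by
    intro p hp
    rw [Finset.mem_filter] at hp
    obtain ⟨i, j, hij, hmod⟩ := exists_pair_of_resCount_lt hp.2
    rw [Finset.mem_biUnion]
    exact ⟨(i, j), by simp [hpairs, hij], Finset.mem_filter.2 ⟨hp.1, hmod⟩⟩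
  have hy1 : (1 : ℝ) < y := by exact_mod_cast (by omega : 1 < y)
  have hlogy : 0 < Real.log y := Real.log_pos hy1
  have hlogh : 0 ≤ Real.log h := Real.log_natCast_nonneg h
  have heach : ∀ ij ∈ pairs,
      (#(PR.filter fun p => t ij.1 % p = t ij.2 % p) : ℝ) ≤ Real.log h / Real.log y := by
    rintro ⟨i, j⟩ hij
    simp only [hpairs, Finset.mem_filter, Finset.mem_univ, true_and] at hij
    -- `d = |t i − t j|` as a natural number
    have hti := Finset.mem_Icc.1 (hth i)
    have htj := Finset.mem_Icc.1 (hth j)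
    have hne : t i ≠ t j := fun h => hij (ht h)
    rcases Nat.lt_or_gt_of_ne hne with hlt | hlt
    · refine card_primes_dvd_le (d := t j - t i) (by omega) (by omega) hy _ fun p hp => ?_
      rw [Finset.mem_filter] at hp
      refine ⟨(hPR p hp.1).1, (hPR p hp.1).2, ?_⟩
      exact (Nat.modEq_iff_dvd' hlt.le).1 hp.2
    · refine card_primes_dvd_le (d := t i - t j) (by omega) (by omega) hy _ fun p hp => ?_
      rw [Finset.mem_filter] at hp
      refine ⟨(hPR p hp.1).1, (hPR p hp.1).2, ?_⟩
      exact (Nat.modEq_iff_dvd' hlt.le).1 hp.2.symm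
  calc (#(PR.filter fun p => resCount p t < k) : ℝ)
      ≤ #(pairs.biUnion fun ij => PR.filter fun p => t ij.1 % p = t ij.2 % p) := by
        exact_mod_cast Finset.card_le_card hcover
    _ ≤ ∑ ij ∈ pairs, (#(PR.filter fun p => t ij.1 % p = t ij.2 % p) : ℝ) := by
        exact_mod_cast Finset.card_biUnion_le
    _ ≤ ∑ ij ∈ pairs, Real.log h / Real.log y := Finset.sum_le_sum heach
    _ = #pairs * (Real.log h / Real.log y) := by rw [Finset.sum_const, nsmul_eq_mul]
    _ ≤ (k : ℝ) ^ 2 * (Real.log h / Real.log y) := by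
        apply mul_le_mul_of_nonneg_right _ (div_nonneg hlogh hlogy.le)
        have : #pairs ≤ k ^ 2 := by
          calc #pairs ≤ #(univ : Finset (Fin k × Fin k)) := Finset.card_filter_le _ _
            _ = k ^ 2 := by simp [sq]
        exact_mod_cast this



/-- Tail of the Euler product: over any finite set of primes `> y ≥ max(2, k²)`, for an injective
tuple in `[1, h]^k`, `1 − 2k²/y ≤ ∏ f_p(t) ≤ exp((2k/y) · k² log h / log y)` (generic primes
contribute `∏ (1 − k²/p²) ≥ 1 − ∑_{p>y} k²/p²`, exceptional ones at most `exp(2k/y)` each).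
[cite: Gallagher1976, eq. 7] -/
theorem prod_localFactor_bounds {k h y : ℕ} (hy2 : 2 ≤ y) (hyk : k * k ≤ y) {t : Fin k → ℕ}
    (ht : Function.Injective t) (hth : ∀ j, t j ∈ Icc 1 h) (PR : Finset ℕ)
    (hPR : ∀ p ∈ PR, p.Prime ∧ y < p) :
    1 - 2 * (k : ℝ) ^ 2 / y ≤ ∏ p ∈ PR, localFactor k p t ∧
      ∏ p ∈ PR, localFactor k p t ≤
        Real.exp (2 * k / y * ((k : ℝ) ^ 2 * (Real.log h / Real.log y))) := by
  classical
  have hkp : ∀ p ∈ PR, k < p := fun p hp =>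
    lt_of_le_of_lt ((Nat.le_mul_self k).trans hyk) (hPR p hp).2
  have hkkp : ∀ p ∈ PR, k * k ≤ p := fun p hp => hyk.trans (hPR p hp).2.le
  have hy0 : (0 : ℝ) < y := by exact_mod_cast (by omega : 0 < y)
  -- split into `A = {ν = k}` and `B = {ν < k}`
  have hsplit : ∏ p ∈ PR, localFactor k p t =
      (∏ p ∈ PR.filter (fun p => resCount p t = k), localFactor k p t) *
        ∏ p ∈ PR.filter (fun p => ¬ resCount p t = k), localFactor k p t :=
    (Finset.prod_filter_mul_prod_filter_not PR (fun p => resCount p t = k) _).symm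
  have hBlt : ∀ p ∈ PR.filter (fun p => ¬ resCount p t = k), resCount p t < k := fun p hp =>
    lt_of_le_of_ne (resCount_le p t) (Finset.mem_filter.1 hp).2
  -- bounds on the `A`-product
  have hA1 : ∏ p ∈ PR.filter (fun p => resCount p t = k), localFactor k p t ≤ 1 := by
    refine Finset.prod_le_one (fun p hp => ?_) (fun p hp => ?_)
    · obtain ⟨hp1, hp2⟩ := Finset.mem_filter.1 hp
      have := (localFactor_bounds_of_eq (hPR p hp1).1 (hkp p hp1) hp2).1
      have hk2 : (k : ℝ) ^ 2 / (p : ℝ) ^ 2 ≤ 1 := by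
        rw [div_le_one (by have := (hPR p hp1).1.pos; positivity)]
        have : (k : ℝ) < p := by exact_mod_cast hkp p hp1
        nlinarith
      linarith
    · obtain ⟨hp1, hp2⟩ := Finset.mem_filter.1 hp
      exact (localFactor_bounds_of_eq (hPR p hp1).1 (hkp p hp1) hp2).2
  have hA0 : 0 ≤ ∏ p ∈ PR.filter (fun p => resCount p t = k), localFactor k p t :=
    Finset.prod_nonneg fun p hp => localFactor_nonneg k (hPR p (Finset.mem_filter.1 hp).1).1.pos t
  have hA2 : 1 - 2 * (k : ℝ) ^ 2 / y ≤
      ∏ p ∈ PR.filter (fun p => resCount p t = k), localFactor k p t := by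
    -- `∏ f_p ≥ ∏ (1 − k²/p²) ≥ 1 − ∑ k²/p² ≥ 1 − 2k²/y`
    have step1 : ∏ p ∈ PR.filter (fun p => resCount p t = k), (1 - (k : ℝ) ^ 2 / (p : ℝ) ^ 2) ≤
        ∏ p ∈ PR.filter (fun p => resCount p t = k), localFactor k p t := by
      refine Finset.prod_le_prod (fun p hp => ?_) (fun p hp => ?_)
      · obtain ⟨hp1, -⟩ := Finset.mem_filter.1 hp
        rw [sub_nonneg, div_le_one (by have := (hPR p hp1).1.pos; positivity)]
        have : (k : ℝ) < p := by exact_mod_cast hkp p hp1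
        nlinarith
      · obtain ⟨hp1, hp2⟩ := Finset.mem_filter.1 hp
        exact (localFactor_bounds_of_eq (hPR p hp1).1 (hkp p hp1) hp2).1
    have step2 : 1 - ∑ p ∈ PR.filter (fun p => resCount p t = k), (k : ℝ) ^ 2 / (p : ℝ) ^ 2 ≤
        ∏ p ∈ PR.filter (fun p => resCount p t = k), (1 - (k : ℝ) ^ 2 / (p : ℝ) ^ 2) := by
      -- Weierstrass's inequality `1 − ∑ aᵢ ≤ ∏ (1 − aᵢ)`: Bonferroni at `r = 0`
      -- (`Literature.NumberTheory.Sieve.BrunPureSieve.bonferroniSum_le_prod_one_sub_add`)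
      have h1 : ∀ p ∈ PR.filter (fun p => resCount p t = k), (k : ℝ) ^ 2 / (p : ℝ) ^ 2 ≤ 1 := by
        intro p hp
        obtain ⟨hp1, -⟩ := Finset.mem_filter.1 hp
        rw [div_le_one (by have := (hPR p hp1).1.pos; positivity)]
        have : (k : ℝ) < p := by exact_mod_cast hkp p hp1
        nlinarith
      have h := Literature.NumberTheory.Sieve.BrunPureSieve.bonferroniSum_le_prod_one_sub_add
        (PR.filter (fun p => resCount p t = k)) (fun p : ℕ => (k : ℝ) ^ 2 / (p : ℝ) ^ 2)
        (fun p _ => by positivity) h1 (r := 0) Even.zero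
      simp only [zero_add, range_one, sum_singleton, pow_zero, one_mul, powersetCard_zero,
        prod_empty, powersetCard_one, sum_map, Function.Embedding.coeFn_mk, prod_singleton,
        sum_singleton] at h
      linarith
    have step3 : ∑ p ∈ PR.filter (fun p => resCount p t = k), (k : ℝ) ^ 2 / (p : ℝ) ^ 2 ≤
        2 * (k : ℝ) ^ 2 / y := by
      calc ∑ p ∈ PR.filter (fun p => resCount p t = k), (k : ℝ) ^ 2 / (p : ℝ) ^ 2
          ≤ ∑ p ∈ PR, (k : ℝ) ^ 2 / (p : ℝ) ^ 2 :=
            Finset.sum_le_sum_of_subset_of_nonneg (Finset.filter_subset _ _)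
              (fun p _ _ => by positivity)
        _ = (k : ℝ) ^ 2 * ∑ p ∈ PR, ((p : ℝ) ^ 2)⁻¹ := by
            rw [Finset.mul_sum]; refine Finset.sum_congr rfl fun p _ => ?_; rw [div_eq_mul_inv]
        _ ≤ (k : ℝ) ^ 2 * ∑ n ∈ Ioo y (PR.sup id + 1), ((n : ℝ) ^ 2)⁻¹ := by
            apply mul_le_mul_of_nonneg_left _ (by positivity)
            apply Finset.sum_le_sum_of_subset_of_nonneg
            · intro p hp
              rw [Finset.mem_Ioo]
              exact ⟨(hPR p hp).2, Nat.lt_succ_of_le (Finset.le_sup (f := id) hp)⟩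
            · intro n _ _; positivity
        _ ≤ (k : ℝ) ^ 2 * (2 / ((y : ℝ) + 1)) :=
            mul_le_mul_of_nonneg_left (sum_Ioo_inv_sq_le y _) (by positivity)
        _ ≤ 2 * (k : ℝ) ^ 2 / y := by
            rw [mul_div_assoc', mul_comm ((k : ℝ) ^ 2) 2]
            apply div_le_div_of_nonneg_left (by positivity) hy0 (by linarith)
    linarith
  -- bounds on the `B`-product
  have hB1 : 1 ≤ ∏ p ∈ PR.filter (fun p => ¬ resCount p t = k), localFactor k p t :=
    Finset.one_le_prod fun p hp =>
      (localFactor_bounds_of_lt (hPR p (Finset.mem_filter.1 hp).1).1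
        (hkkp p (Finset.mem_filter.1 hp).1) (hBlt p hp)).1
  have hB2 : ∏ p ∈ PR.filter (fun p => ¬ resCount p t = k), localFactor k p t ≤
      Real.exp (2 * k / y * ((k : ℝ) ^ 2 * (Real.log h / Real.log y))) := by
    calc ∏ p ∈ PR.filter (fun p => ¬ resCount p t = k), localFactor k p t
        ≤ ∏ p ∈ PR.filter (fun p => ¬ resCount p t = k), Real.exp (2 * k / y) := by
          refine Finset.prod_le_prod (fun p hp => ?_) (fun p hp => ?_)
          · exact localFactor_nonneg k (hPR p (Finset.mem_filter.1 hp).1).1.pos t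
          · have hp1 := (Finset.mem_filter.1 hp).1
            refine ((localFactor_bounds_of_lt (hPR p hp1).1 (hkkp p hp1) (hBlt p hp)).2).trans ?_
            apply Real.exp_le_exp.2
            have : (y : ℝ) < p := by exact_mod_cast (hPR p hp1).2
            exact div_le_div_of_nonneg_left (by positivity) hy0 this.le
      _ = Real.exp (2 * k / y) ^ #(PR.filter (fun p => ¬ resCount p t = k)) := Finset.prod_const _
      _ = Real.exp (2 * k / y * #(PR.filter (fun p => ¬ resCount p t = k))) := by
          rw [← Real.exp_nat_mul]; ring_nf
      _ ≤ Real.exp (2 * k / y * ((k : ℝ) ^ 2 * (Real.log h / Real.log y))) := by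
          apply Real.exp_le_exp.2
          apply mul_le_mul_of_nonneg_left _ (by positivity)
          have hB : (PR.filter fun p => ¬ resCount p t = k) =
              PR.filter fun p => resCount p t < k := by
            ext p
            simp only [Finset.mem_filter, and_congr_right_iff]
            intro _
            exact ⟨fun h => lt_of_le_of_ne (resCount_le p t) h, fun h => h.ne⟩
          rw [hB]
          exact card_filter_resCount_lt_le hy2 ht hth PR hPR
  have hB0 : 0 ≤ ∏ p ∈ PR.filter (fun p => ¬ resCount p t = k), localFactor k p t :=
    le_trans zero_le_one hB1
  rw [hsplit]
  constructor
  · calc 1 - 2 * (k : ℝ) ^ 2 / y ≤ ∏ p ∈ PR.filter (fun p => resCount p t = k), localFactor k p t :=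
        hA2
      _ = (∏ p ∈ PR.filter (fun p => resCount p t = k), localFactor k p t) * 1 := (mul_one _).symm
      _ ≤ _ := mul_le_mul_of_nonneg_left hB1 hA0
  · calc (∏ p ∈ PR.filter (fun p => resCount p t = k), localFactor k p t) *
          ∏ p ∈ PR.filter (fun p => ¬ resCount p t = k), localFactor k p t
        ≤ 1 * ∏ p ∈ PR.filter (fun p => ¬ resCount p t = k), localFactor k p t :=
          mul_le_mul_of_nonneg_right hA1 hB0
      _ ≤ _ := by rw [one_mul]; exact hB2

/-- Truncation of the singular series: for `y ≥ max(2, k²)` and an injective tuple `t ∈ [1, h]^k`,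
`truncProd · (1 − 2k²/y) ≤ 𝔖(t) ≤ truncProd · exp((2k/y) k² log h / log y)`, by passing to the
limit in `prod_localFactor_bounds` (`Literature.NumberTheory.Sieve.tendsto_singularSeriesPartial_holds`).
[cite: Gallagher1976, eq. 7] -/
theorem singularSeries_tupleSet_bounds {k h y : ℕ} (hy2 : 2 ≤ y) (hyk : k * k ≤ y)
    {t : Fin k → ℕ} (ht : Function.Injective t) (hth : ∀ j, t j ∈ Icc 1 h) :
    truncProd k y t * (1 - 2 * (k : ℝ) ^ 2 / y) ≤ singularSeries (tupleSet t) ∧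
      singularSeries (tupleSet t) ≤
        truncProd k y t * Real.exp (2 * k / y * ((k : ℝ) ^ 2 * (Real.log h / Real.log y))) := by
  have hlim := tendsto_singularSeriesPartial_holds (tupleSet t)
  have hTP := truncProd_nonneg k y t
  have hpart : ∀ z, y ≤ z → singularSeriesPartial (tupleSet t) z =
      truncProd k y t * ∏ p ∈ Nat.primesLE z \ Nat.primesLE y, localFactor k p t := by
    intro z hz
    rw [singularSeriesPartial_tupleSet ht z]
    unfold truncProd
    rw [mul_comm, Finset.prod_sdiff]
    intro p hp
    rw [Nat.mem_primesLE] at hp ⊢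
    exact ⟨hp.1.trans hz, hp.2⟩
  have hPR : ∀ z, ∀ p ∈ Nat.primesLE z \ Nat.primesLE y, p.Prime ∧ y < p := by
    intro z p hp
    rw [Finset.mem_sdiff, Nat.mem_primesLE, Nat.mem_primesLE] at hp
    refine ⟨hp.1.2, ?_⟩
    by_contra hle
    exact hp.2 ⟨not_lt.1 hle, hp.1.2⟩
  constructor
  · refine ge_of_tendsto hlim ?_
    rw [Filter.eventually_atTop]
    refine ⟨y, fun z hz => ?_⟩
    rw [hpart z hz]
    exact mul_le_mul_of_nonneg_left
      (prod_localFactor_bounds hy2 hyk ht hth _ (hPR z)).1 hTP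
  · refine le_of_tendsto hlim ?_
    rw [Filter.eventually_atTop]
    refine ⟨y, fun z hz => ?_⟩
    rw [hpart z hz]
    exact mul_le_mul_of_nonneg_left
      (prod_localFactor_bounds hy2 hyk ht hth _ (hPR z)).2 hTP

/-! #### Periodicity -/

/-- `ν_p` is `n`-periodic in `t` for `p ∣ n`. [folklore] -/
theorem resCount_modVec {k p n : ℕ} (hpn : p ∣ n) (t : Fin k → ℕ) :
    resCount p (modVec n t) = resCount p t := by
  unfold resCount modVec
  congr 1
  refine Finset.image_congr fun j _ => ?_
  exact Nat.mod_mod_of_dvd (t j) hpn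

/-- The Euler factor at `p` is `n`-periodic in `t` for `p ∣ n`. [folklore] -/
theorem localFactor_modVec {k p n : ℕ} (hpn : p ∣ n) (t : Fin k → ℕ) :
    localFactor k p (modVec n t) = localFactor k p t := by
  unfold localFactor
  rw [resCount_modVec hpn]

/-- A product of Euler factors at primes dividing `n` is `n`-periodic in `t`. [folklore] -/
theorem prod_localFactor_modVec {k n : ℕ} (S : Finset ℕ) (hS : ∀ p ∈ S, p ∣ n) (t : Fin k → ℕ) :
    ∏ p ∈ S, localFactor k p (modVec n t) = ∏ p ∈ S, localFactor k p t :=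
  Finset.prod_congr rfl fun p hp => localFactor_modVec (hS p hp) t

/-- `truncProd k y` is `n`-periodic whenever every prime `p ≤ y` divides `n`. [folklore] -/
theorem truncProd_modVec {k y n : ℕ} (hn : ∀ p ∈ Nat.primesLE y, p ∣ n) (t : Fin k → ℕ) :
    truncProd k y (modVec n t) = truncProd k y t :=
  prod_localFactor_modVec _ hn t

/-! #### Counting residues in boxes -/

/-- In `m` consecutive blocks of length `n`, each residue `v < n` occurs exactly `m` times
(from Mathlib's `Nat.count_modEq_card`). [folklore] -/
theorem card_filter_Ico_mod_eq {a m n v : ℕ} (hn : 0 < n) (hv : v < n) :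
    #((Ico a (a + m * n)).filter fun x => x % n = v) = m := by
  have hc : ∀ c, #((range c).filter fun x => x % n = v) = c / n + if v < c % n then 1 else 0 := by
    intro c
    have h := Nat.count_modEq_card c hn v
    rw [Nat.count_eq_card_filter_range, Nat.mod_eq_of_lt hv] at h
    rw [← h]
    congr 1
    ext x
    simp only [mem_filter, Nat.ModEq, Nat.mod_eq_of_lt hv]
  simp only [Finset.range_eq_Ico] at hc
  have hsplit : (Ico 0 (a + m * n)).filter (fun x => x % n = v) =
      (Ico 0 a).filter (fun x => x % n = v) ∪ (Ico a (a + m * n)).filter (fun x => x % n = v) := by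
    rw [← Finset.filter_union, Finset.Ico_union_Ico_eq_Ico (Nat.zero_le a)
      (Nat.le_add_right a (m * n))]
  have hdisj : Disjoint ((Ico 0 a).filter (fun x => x % n = v))
      ((Ico a (a + m * n)).filter (fun x => x % n = v)) :=
    Finset.disjoint_filter_filter (Finset.Ico_disjoint_Ico_consecutive 0 a (a + m * n))
  have hcard := congrArg Finset.card hsplit
  rw [Finset.card_union_of_disjoint hdisj, hc, hc, Nat.add_mul_mod_self_right,
    Nat.add_mul_div_right _ _ hn] at hcard
  split_ifs at hcard <;> omega

/-- The fibre of componentwise reduction over a cube is the cube of the one-dimensional fibres.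
[folklore] -/
theorem filter_piFinset_modVec_eq {k : ℕ} (I : Finset ℕ) (n : ℕ) (u : Fin k → ℕ) :
    (Fintype.piFinset fun _ : Fin k => I).filter (fun t => modVec n t = u) =
      Fintype.piFinset fun j => I.filter fun x => x % n = u j := by
  ext t
  simp only [mem_filter, Fintype.mem_piFinset, funext_iff, modVec_apply]
  exact ⟨fun h j => ⟨h.1 j, h.2 j⟩, fun h => ⟨fun j => (h j).1, fun j => (h j).2⟩⟩

/-- Each residue tuple `u ∈ [0, n)^k` has exactly `m^k` lifts in the cube `[a, a + m n)^k`.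
[folklore] -/
theorem card_filter_piFinset_modVec {k a m n : ℕ} (hn : 0 < n) {u : Fin k → ℕ}
    (hu : u ∈ Fintype.piFinset fun _ : Fin k => range n) :
    #((Fintype.piFinset fun _ : Fin k => Ico a (a + m * n)).filter (fun t => modVec n t = u)) =
      m ^ k := by
  rw [filter_piFinset_modVec_eq, Fintype.card_piFinset]
  rw [Finset.prod_congr rfl fun j _ =>
    card_filter_Ico_mod_eq (a := a) (m := m) hn (mem_range.1 (Fintype.mem_piFinset.1 hu j))]
  simp

/-- The sum of an `n`-periodic function over the cube `[a, a + m n)^k` is `m^k` times its sum over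
one period `[0, n)^k`. [folklore] -/
theorem sum_piFinset_Ico_of_periodic {k n : ℕ} (hn : 0 < n) (a m : ℕ) (f : (Fin k → ℕ) → ℝ)
    (hf : ∀ t, f (modVec n t) = f t) :
    ∑ t ∈ Fintype.piFinset (fun _ : Fin k => Ico a (a + m * n)), f t =
      (m : ℝ) ^ k * ∑ u ∈ Fintype.piFinset (fun _ : Fin k => range n), f u := by
  have hmaps : ∀ t ∈ Fintype.piFinset (fun _ : Fin k => Ico a (a + m * n)),
      modVec n t ∈ Fintype.piFinset (fun _ : Fin k => range n) :=
    fun t _ => Fintype.mem_piFinset.2 fun j => mem_range.2 (Nat.mod_lt _ hn)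
  rw [← Finset.sum_fiberwise_of_maps_to hmaps, Finset.mul_sum]
  refine Finset.sum_congr rfl fun u hu => ?_
  have hval : ∀ t ∈ (Fintype.piFinset fun _ : Fin k => Ico a (a + m * n)).filter
      (fun t => modVec n t = u), f t = f u := by
    intro t ht
    rw [← hf t, (mem_filter.1 ht).2]
  rw [Finset.sum_congr rfl hval, Finset.sum_const, nsmul_eq_mul, card_filter_piFinset_modVec hn hu]
  push_cast
  ring

/-! #### The exact local identity -/

/-- `∑_{x ∈ [0, p)^k} (p − #{x₀, …, x_{k−1}}) = p (p − 1)^k`: count the pairs `(x, c)` with `c`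
not a value of `x` (the exact identity behind Gallagher's `A(q) = 0 for q > 1`, p. 7, there obtained
from the Stirling-number identities (i)–(ii) of his §3). [cite: Gallagher1976, Section 2 p. 7] -/
theorem sum_sub_card_image {k : ℕ} (p : ℕ) :
    ∑ x ∈ Fintype.piFinset (fun _ : Fin k => range p), ((p : ℝ) - #(univ.image x)) =
      p * ((p : ℝ) - 1) ^ k := by
  set Rp := Fintype.piFinset (fun _ : Fin k => range p) with hRp
  have h1 : ∀ x ∈ Rp, ((p : ℝ) - #(univ.image x)) =
      ∑ c ∈ range p, if c ∉ univ.image x then (1 : ℝ) else 0 := by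
    intro x hx
    rw [Finset.sum_boole]
    have hsub : univ.image x ⊆ range p := by
      intro c hc
      obtain ⟨j, -, rfl⟩ := mem_image.1 hc
      exact Fintype.mem_piFinset.1 hx j
    rw [Finset.filter_not, Finset.card_sdiff_of_subset (filter_subset _ _)]
    have : (range p).filter (fun c => c ∈ univ.image x) = univ.image x := by
      ext c
      simp only [mem_filter]
      exact ⟨fun h => h.2, fun h => ⟨hsub h, h⟩⟩
    rw [this, card_range, Nat.cast_sub (by simpa using card_le_card hsub)]
  rw [Finset.sum_congr rfl h1, Finset.sum_comm]
  have h2 : ∀ c ∈ range p,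
      ∑ x ∈ Rp, (if c ∉ univ.image x then (1 : ℝ) else 0) = ((p : ℝ) - 1) ^ k := by
    intro c hc
    rw [Finset.sum_boole]
    have : Rp.filter (fun x => c ∉ univ.image x) =
        Fintype.piFinset (fun _ : Fin k => (range p).erase c) := by
      ext x
      simp only [hRp, mem_filter, Fintype.mem_piFinset, mem_erase, mem_image, mem_univ, true_and,
        not_exists]
      exact ⟨fun h j => ⟨fun e => h.2 j e, h.1 j⟩,
        fun h => ⟨fun j => (h j).2, fun j e => (h j).1 e⟩⟩
    rw [this, Fintype.card_piFinset_const, Finset.card_erase_of_mem hc, card_range]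
    have hp : 1 ≤ p := by have := mem_range.1 hc; omega
    push_cast [Nat.cast_sub hp]
    ring
  rw [Finset.sum_congr rfl h2, sum_const, card_range, nsmul_eq_mul]

/-- Gallagher's exact local identity: the Euler factor at `p` averages to exactly `1` over all
residue tuples, `∑_{x ∈ [0, p)^k} (1 − ν_p(x)/p)(1 − 1/p)^{−k} = p^k` (his `A(q) = 0 for q > 1`,
pp. 7–8).
[cite: Gallagher1976, Section 2 p. 7] -/
theorem sum_localFactor_range {k p : ℕ} (hp : 1 < p) :
    ∑ x ∈ Fintype.piFinset (fun _ : Fin k => range p), localFactor k p x = (p : ℝ) ^ k := by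
  have hp0 : (0 : ℝ) < p := by exact_mod_cast (zero_lt_one.trans hp)
  have hp1 : (0 : ℝ) < (p : ℝ) - 1 := by
    have : (1 : ℝ) < p := by exact_mod_cast hp
    linarith
  have hres : ∀ x ∈ Fintype.piFinset (fun _ : Fin k => range p),
      (resCount p x : ℝ) = #(univ.image x) := by
    intro x hx
    unfold resCount
    congr 2
    refine Finset.image_congr fun j _ => ?_
    exact Nat.mod_eq_of_lt (mem_range.1 (Fintype.mem_piFinset.1 hx j))
  have e : ∀ x ∈ Fintype.piFinset (fun _ : Fin k => range p), localFactor k p x =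
      ((p : ℝ) - #(univ.image x)) * ((1 / p) * (1 - 1 / (p : ℝ))⁻¹ ^ k) := by
    intro x hx
    unfold localFactor
    rw [hres x hx]
    field_simp
  rw [Finset.sum_congr rfl e, ← Finset.sum_mul, sum_sub_card_image]
  have hinv : (1 - 1 / (p : ℝ))⁻¹ = p / ((p : ℝ) - 1) := by
    field_simp
  rw [hinv, div_pow]
  field_simp

/-! #### Independence of the local factors (Chinese remainder theorem) -/

/-- Chinese remainder theorem, counting form (Gallagher p. 7: "a simple lattice point argument
using the Chinese remainder theorem"): for coprime `p`, `P'`, on the fibre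
`{t ∈ [0, p P')^k : t ≡ u (P')}` reduction modulo `p` is a bijection onto `[0, p)^k`, so a
`p`-periodic function has the same sum over the fibre as over one period.
[cite: Gallagher1976, Section 2 p. 7] -/
theorem sum_filter_modVec_eq {k p P' : ℕ} (hp : 0 < p) (hP' : 0 < P') (hcop : Nat.Coprime p P')
    (g : (Fin k → ℕ) → ℝ) (hg : ∀ t, g (modVec p t) = g t)
    {u : Fin k → ℕ} (hu : u ∈ Fintype.piFinset fun _ : Fin k => range P') :
    ∑ t ∈ (Fintype.piFinset fun _ : Fin k => range (p * P')).filter (fun t => modVec P' t = u),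
        g t = ∑ x ∈ Fintype.piFinset (fun _ : Fin k => range p), g x := by
  set Φ := (Fintype.piFinset fun _ : Fin k => range (p * P')).filter (fun t => modVec P' t = u)
    with hΦ
  have hcardΦ : #Φ = p ^ k := by
    have := card_filter_piFinset_modVec (a := 0) (m := p) hP' hu
    rwa [zero_add, ← Finset.range_eq_Ico] at this
  have hinj : Set.InjOn (modVec p) (Φ : Set (Fin k → ℕ)) := by
    intro t ht t' ht' heq
    rw [hΦ, coe_filter, Set.mem_setOf_eq, Fintype.mem_piFinset] at ht ht'
    funext j
    have h1 : t j % p = t' j % p := congrFun heq j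
    have h2 : t j % P' = t' j % P' := by
      have := congrFun ht.2 j
      have h' := congrFun ht'.2 j
      rw [modVec_apply] at this h'
      rw [this, h']
    have h12 : t j ≡ t' j [MOD p * P'] := (Nat.modEq_and_modEq_iff_modEq_mul hcop).1 ⟨h1, h2⟩
    exact Nat.ModEq.eq_of_lt_of_lt h12 (mem_range.1 (ht.1 j)) (mem_range.1 (ht'.1 j))
  have himage : Φ.image (modVec p) = Fintype.piFinset (fun _ : Fin k => range p) := by
    apply Finset.eq_of_subset_of_card_le
    · intro x hx
      obtain ⟨t, -, rfl⟩ := mem_image.1 hx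
      exact Fintype.mem_piFinset.2 fun j => mem_range.2 (Nat.mod_lt _ hp)
    · rw [Finset.card_image_of_injOn hinj, hcardΦ, Fintype.card_piFinset_const, card_range]
  calc ∑ t ∈ Φ, g t = ∑ t ∈ Φ, g (modVec p t) := Finset.sum_congr rfl fun t _ => (hg t).symm
    _ = ∑ x ∈ Φ.image (modVec p), g x := (Finset.sum_image hinj).symm
    _ = _ := by rw [himage]

/-- Independence of the Euler factors at distinct primes: for a finite set `S` of primes with
product `P_S`, `∑_{r ∈ [0, P_S)^k} ∏_{p ∈ S} f_p(r) = P_S^k` (induction on `S` via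
`sum_filter_modVec_eq` and `sum_localFactor_range`). [cite: Gallagher1976, Section 2 p. 7] -/
theorem sum_prod_localFactor {k : ℕ} (S : Finset ℕ) (hS : ∀ p ∈ S, p.Prime) :
    ∑ r ∈ Fintype.piFinset (fun _ : Fin k => range (∏ p ∈ S, p)), ∏ p ∈ S, localFactor k p r =
      ((∏ p ∈ S, p : ℕ) : ℝ) ^ k := by
  induction S using Finset.induction_on with
  | empty =>
    simp
  | insert p S hpS ih =>
    have hp : p.Prime := hS p (mem_insert_self _ _)
    have hS' : ∀ q ∈ S, q.Prime := fun q hq => hS q (mem_insert_of_mem hq)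
    have ih' := ih hS'
    have hP'pos : 0 < ∏ q ∈ S, q := Finset.prod_pos fun q hq => (hS' q hq).pos
    have hcop : Nat.Coprime p (∏ q ∈ S, q) :=
      Nat.Coprime.prod_right fun q hq =>
        (Nat.coprime_primes hp (hS' q hq)).2 fun h => hpS (h ▸ hq)
    rw [Finset.prod_insert hpS]
    simp_rw [Finset.prod_insert hpS]
    have hmaps : ∀ r ∈ Fintype.piFinset (fun _ : Fin k => range (p * ∏ q ∈ S, q)),
        modVec (∏ q ∈ S, q) r ∈ Fintype.piFinset (fun _ : Fin k => range (∏ q ∈ S, q)) :=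
      fun r _ => Fintype.mem_piFinset.2 fun j => mem_range.2 (Nat.mod_lt _ hP'pos)
    rw [← Finset.sum_fiberwise_of_maps_to hmaps]
    have hinner : ∀ u ∈ Fintype.piFinset (fun _ : Fin k => range (∏ q ∈ S, q)),
        ∑ r ∈ (Fintype.piFinset fun _ : Fin k => range (p * ∏ q ∈ S, q)).filter
            (fun r => modVec (∏ q ∈ S, q) r = u),
          localFactor k p r * ∏ q ∈ S, localFactor k q r =
            (p : ℝ) ^ k * ∏ q ∈ S, localFactor k q u := by
      intro u hu
      have hF : ∀ r ∈ (Fintype.piFinset fun _ : Fin k => range (p * ∏ q ∈ S, q)).filter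
          (fun r => modVec (∏ q ∈ S, q) r = u),
          ∏ q ∈ S, localFactor k q r = ∏ q ∈ S, localFactor k q u := by
        intro r hr
        rw [← prod_localFactor_modVec S (fun q hq => Finset.dvd_prod_of_mem _ hq) r,
          (mem_filter.1 hr).2]
      rw [Finset.sum_congr rfl fun r hr => by rw [hF r hr], ← Finset.sum_mul,
        sum_filter_modVec_eq hp.pos hP'pos hcop (localFactor k p)
          (fun t => localFactor_modVec (dvd_refl p) t) hu,
        sum_localFactor_range hp.one_lt]
    rw [Finset.sum_congr rfl hinner, ← Finset.mul_sum, ih', Nat.cast_mul, mul_pow]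

/-- `∑_{r ∈ [0, P)^k} truncProd k y r = P^k` for the primorial `P = ∏_{p ≤ y} p`.
[cite: Gallagher1976, Section 2 p. 7] -/
theorem sum_truncProd_range (k y : ℕ) :
    ∑ r ∈ Fintype.piFinset (fun _ : Fin k => range (primorial y)), truncProd k y r =
      ((primorial y : ℕ) : ℝ) ^ k := by
  rw [primorial_eq_prod_primesLE]
  exact sum_prod_localFactor (Nat.primesLE y) fun p hp => (Nat.mem_primesLE.1 hp).2

/-- Every prime `p ≤ y` divides the primorial of `y`. [folklore] -/
theorem dvd_primorial_of_mem_primesLE {y p : ℕ} (hp : p ∈ Nat.primesLE y) : p ∣ primorial y := by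
  rw [primorial_eq_prod_primesLE]
  exact Finset.dvd_prod_of_mem _ hp

/-- Over `m` full periods in each coordinate the truncated product sums to exactly `(m P)^k`,
`P` the primorial of `y`. [folklore] -/
theorem sum_truncProd_box (k y a m : ℕ) :
    ∑ t ∈ Fintype.piFinset (fun _ : Fin k => Ico a (a + m * primorial y)), truncProd k y t =
      ((m * primorial y : ℕ) : ℝ) ^ k := by
  rw [sum_piFinset_Ico_of_periodic (primorial_pos y) a m (truncProd k y)
      (fun t => truncProd_modVec (fun p hp => dvd_primorial_of_mem_primesLE hp) t),
    sum_truncProd_range]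
  push_cast
  ring

/-- The sum of the truncated product over the cube `[1, h]^k` lies between `(m P)^k` and
`((m + 1) P)^k`, `m = ⌊h/P⌋`, `P` the primorial of `y` (monotonicity in the cube, the terms being
nonnegative). [folklore] -/
theorem sum_truncProd_Icc_bounds (k y h : ℕ) :
    (((h / primorial y) * primorial y : ℕ) : ℝ) ^ k ≤
        ∑ t ∈ Fintype.piFinset (fun _ : Fin k => Icc 1 h), truncProd k y t ∧
      ∑ t ∈ Fintype.piFinset (fun _ : Fin k => Icc 1 h), truncProd k y t ≤
        (((h / primorial y + 1) * primorial y : ℕ) : ℝ) ^ k := by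
  have hmP : h / primorial y * primorial y ≤ h := Nat.div_mul_le_self h _
  have hlt : h < (h / primorial y + 1) * primorial y := by
    rw [Nat.add_mul, one_mul]
    exact Nat.lt_div_mul_add (primorial_pos y)
  constructor
  · rw [← sum_truncProd_box k y 1 (h / primorial y)]
    apply Finset.sum_le_sum_of_subset_of_nonneg
    · exact Fintype.piFinset_subset _ _ fun _ => fun x hx => by
        rw [Finset.mem_Ico] at hx
        rw [Finset.mem_Icc]
        omega
    · exact fun t _ _ => truncProd_nonneg k y t
  · rw [← sum_truncProd_box k y 1 (h / primorial y + 1)]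
    apply Finset.sum_le_sum_of_subset_of_nonneg
    · exact Fintype.piFinset_subset _ _ fun _ => fun x hx => by
        rw [Finset.mem_Icc] at hx
        rw [Finset.mem_Ico]
        omega
    · exact fun t _ _ => truncProd_nonneg k y t

/-! #### Few tuples are non-distinct -/

/-- At most `k² h^{k−1}` of the `h^k` tuples in `[1, h]^k` have a repeated entry (Gallagher p. 7
absorbs the not necessarily distinct tuples the same way). [folklore] -/
theorem card_filter_not_injective_le (k h : ℕ) :
    #((Fintype.piFinset fun _ : Fin k => Icc 1 h).filter (fun t => ¬ Function.Injective t)) ≤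
      k * k * h ^ (k - 1) := by
  classical
  set B := Fintype.piFinset fun _ : Fin k => Icc 1 h with hB
  have hcover : B.filter (fun t => ¬ Function.Injective t) ⊆
      (univ : Finset (Fin k × Fin k)).biUnion
        fun ij => B.filter (fun t => ij.1 ≠ ij.2 ∧ t ij.1 = t ij.2) := by
    intro t ht
    rw [mem_filter] at ht
    obtain ⟨i, j, hval, hij⟩ : ∃ i j, t i = t j ∧ i ≠ j := by
      have := ht.2
      simp only [Function.Injective, not_forall] at this
      obtain ⟨i, j, hval, hij⟩ := this
      exact ⟨i, j, hval, hij⟩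
    exact mem_biUnion.2 ⟨(i, j), mem_univ _, mem_filter.2 ⟨ht.1, hij, hval⟩⟩
  have heach : ∀ ij : Fin k × Fin k,
      #(B.filter (fun t => ij.1 ≠ ij.2 ∧ t ij.1 = t ij.2)) ≤ h ^ (k - 1) := by
    rintro ⟨i, j⟩
    by_cases hij : i = j
    · simp [hij]
    rcases Nat.eq_zero_or_pos h with hh | hh
    · -- the box is empty
      have : B = ∅ := by
        rw [hB, Fintype.piFinset_eq_empty]
        exact ⟨i, by simp [hh]⟩
      simp [this]
    have h1 : (1 : ℕ) ∈ Icc 1 h := Finset.mem_Icc.2 ⟨le_rfl, hh⟩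
    calc #(B.filter (fun t => (i, j).1 ≠ (i, j).2 ∧ t (i, j).1 = t (i, j).2))
        ≤ #(B.filter (fun t => t i = 1)) := by
          refine Finset.card_le_card_of_injOn (fun t => Function.update t i 1) ?_ ?_
          · intro t ht
            rw [Finset.mem_coe, mem_filter] at ht ⊢
            refine ⟨Fintype.mem_piFinset.2 fun l => ?_, by simp⟩
            dsimp only
            rcases eq_or_ne l i with rfl | hl
            · simp [h1]
            · rw [Function.update_of_ne hl]
              exact Fintype.mem_piFinset.1 ht.1 l
          · intro t ht t' ht' heq
            rw [Finset.mem_coe, mem_filter] at ht ht'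
            have hoff : ∀ l, l ≠ i → t l = t' l := by
              intro l hl
              have := congrFun heq l
              simpa only [Function.update_of_ne hl] using this
            funext l
            rcases eq_or_ne l i with rfl | hl
            · rw [ht.2.2, ht'.2.2]
              exact hoff j (Ne.symm hij)
            · exact hoff l hl
      _ = h ^ (k - 1) := by
          rw [hB, Fintype.card_filter_piFinset_const_eq_of_mem _ _ h1, Nat.card_Icc,
            Fintype.card_fin]
          simp
  calc #(B.filter (fun t => ¬ Function.Injective t))
      ≤ #((univ : Finset (Fin k × Fin k)).biUnion
          fun ij => B.filter (fun t => ij.1 ≠ ij.2 ∧ t ij.1 = t ij.2)) := card_le_card hcover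
    _ ≤ ∑ ij : Fin k × Fin k, #(B.filter (fun t => ij.1 ≠ ij.2 ∧ t ij.1 = t ij.2)) :=
        card_biUnion_le
    _ ≤ ∑ _ij : Fin k × Fin k, h ^ (k - 1) := sum_le_sum fun ij _ => heach ij
    _ = k * k * h ^ (k - 1) := by
        rw [sum_const, card_univ, Fintype.card_prod, Fintype.card_fin, smul_eq_mul]


/-! #### Assembly: Gallagher's theorem -/

/-- Two-sided bound for `T(h) = ∑_{t ∈ [1,h]^k distinct} 𝔖(t)` at a truncation level
`y ≥ max(2, 2k²)`:
`(1 − 2k²/y)((mP)^k − k² h^{k−1} y^k) ≤ T(h) ≤ exp((2k/y) k² log h / log y) ((m+1)P)^k` with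
`P` the primorial of `y` and `m = ⌊h/P⌋`. [folklore] -/
theorem sum_singularSeries_bounds {k y : ℕ} (hy2 : 2 ≤ y) (hyk : 2 * k * k ≤ y) (h : ℕ) :
    (1 - 2 * (k : ℝ) ^ 2 / y) *
        ((((h / primorial y) * primorial y : ℕ) : ℝ) ^ k -
          ((k * k * h ^ (k - 1) : ℕ) : ℝ) * (y : ℝ) ^ k) ≤
      ∑ t ∈ (Fintype.piFinset fun _ : Fin k => Icc 1 h).filter (fun t => Function.Injective t),
        singularSeries (tupleSet t) ∧
    ∑ t ∈ (Fintype.piFinset fun _ : Fin k => Icc 1 h).filter (fun t => Function.Injective t),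
        singularSeries (tupleSet t) ≤
      Real.exp (2 * k / y * ((k : ℝ) ^ 2 * (Real.log h / Real.log y))) *
        (((h / primorial y + 1) * primorial y : ℕ) : ℝ) ^ k := by
  set B := Fintype.piFinset fun _ : Fin k => Icc 1 h with hB
  have hmem : ∀ t ∈ B.filter (fun t => Function.Injective t),
      Function.Injective t ∧ ∀ j, t j ∈ Icc 1 h := fun t ht =>
    ⟨(mem_filter.1 ht).2, fun j => Fintype.mem_piFinset.1 (mem_filter.1 ht).1 j⟩
  have hkk : k * k ≤ y := le_trans (by nlinarith) hyk
  have hy1 : 1 ≤ y := by omega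
  obtain ⟨hBlo, hBhi⟩ := sum_truncProd_Icc_bounds k y h
  have hDB : ∑ t ∈ B.filter (fun t => Function.Injective t), truncProd k y t ≤
      ∑ t ∈ B, truncProd k y t :=
    Finset.sum_le_sum_of_subset_of_nonneg (filter_subset _ _) fun t _ _ => truncProd_nonneg k y t
  have hBD : ∑ t ∈ B, truncProd k y t - ((k * k * h ^ (k - 1) : ℕ) : ℝ) * (y : ℝ) ^ k ≤
      ∑ t ∈ B.filter (fun t => Function.Injective t), truncProd k y t := by
    rw [← Finset.sum_filter_add_sum_filter_not B (fun t => Function.Injective t)]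
    have h1 : ∑ t ∈ B.filter (fun t => ¬ Function.Injective t), truncProd k y t ≤
        ∑ t ∈ B.filter (fun t => ¬ Function.Injective t), (y : ℝ) ^ k :=
      Finset.sum_le_sum fun t _ => truncProd_le_pow k y hy1 t
    rw [Finset.sum_const, nsmul_eq_mul] at h1
    have h2 : (#(B.filter (fun t => ¬ Function.Injective t)) : ℝ) ≤
        ((k * k * h ^ (k - 1) : ℕ) : ℝ) := by
      exact_mod_cast card_filter_not_injective_le k h
    have h3 : (#(B.filter (fun t => ¬ Function.Injective t)) : ℝ) * (y : ℝ) ^ k ≤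
        ((k * k * h ^ (k - 1) : ℕ) : ℝ) * (y : ℝ) ^ k :=
      mul_le_mul_of_nonneg_right h2 (by positivity)
    linarith
  constructor
  · have hfac : 0 ≤ 1 - 2 * (k : ℝ) ^ 2 / y := by
      have hy0 : (0 : ℝ) < y := by exact_mod_cast (show 0 < y by omega)
      rw [sub_nonneg, div_le_one hy0]
      have : ((2 * k * k : ℕ) : ℝ) ≤ y := by exact_mod_cast hyk
      push_cast at this
      nlinarith
    calc (1 - 2 * (k : ℝ) ^ 2 / y) *
          ((((h / primorial y) * primorial y : ℕ) : ℝ) ^ k -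
            ((k * k * h ^ (k - 1) : ℕ) : ℝ) * (y : ℝ) ^ k)
        ≤ (1 - 2 * (k : ℝ) ^ 2 / y) *
            ∑ t ∈ B.filter (fun t => Function.Injective t), truncProd k y t :=
          mul_le_mul_of_nonneg_left (by linarith) hfac
      _ = ∑ t ∈ B.filter (fun t => Function.Injective t),
            truncProd k y t * (1 - 2 * (k : ℝ) ^ 2 / y) := by
          rw [mul_comm, Finset.sum_mul]
      _ ≤ ∑ t ∈ B.filter (fun t => Function.Injective t), singularSeries (tupleSet t) :=
          Finset.sum_le_sum fun t ht =>
            (singularSeries_tupleSet_bounds hy2 hkk (hmem t ht).1 (hmem t ht).2).1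
  · calc ∑ t ∈ B.filter (fun t => Function.Injective t), singularSeries (tupleSet t)
        ≤ ∑ t ∈ B.filter (fun t => Function.Injective t), truncProd k y t *
            Real.exp (2 * k / y * ((k : ℝ) ^ 2 * (Real.log h / Real.log y))) :=
          Finset.sum_le_sum fun t ht =>
            (singularSeries_tupleSet_bounds hy2 hkk (hmem t ht).1 (hmem t ht).2).2
      _ = Real.exp (2 * k / y * ((k : ℝ) ^ 2 * (Real.log h / Real.log y))) *
            ∑ t ∈ B.filter (fun t => Function.Injective t), truncProd k y t := by
          rw [← Finset.sum_mul, mul_comm]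
      _ ≤ Real.exp (2 * k / y * ((k : ℝ) ^ 2 * (Real.log h / Real.log y))) *
            ∑ t ∈ B, truncProd k y t :=
          mul_le_mul_of_nonneg_left hDB (Real.exp_pos _).le
      _ ≤ _ := mul_le_mul_of_nonneg_left hBhi (Real.exp_pos _).le

/-- The truncation level `y(h) = ⌊log₁₆ h⌋` tends to infinity. [folklore] -/
theorem tendsto_nat_log_sixteen : Tendsto (fun h : ℕ => Nat.log 16 h) atTop atTop := by
  refine tendsto_atTop_atTop.2 fun b => ⟨16 ^ b, fun h hh => ?_⟩
  exact Nat.le_log_of_pow_le (by norm_num) hh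

/-- **Gallagher's theorem on the mean of the singular series** (Mathematika 23 (1976), eq. (3),
p. 5:
"for each `r`, `𝔖_d` averages to `1` over cubes: `∑_{1 ≤ d₁, …, d_r ≤ h, distinct} 𝔖_d ∼ h^r`
(`h → ∞`)"; quoted as Goldston–Pintz–Yıldırım 2009, (3.7)). Here for every `k` (Gallagher's `r ≥ 1`;
`k = 0` is the trivial `1 → 1`), over the ordered `k`-tuples of distinct integers in `[1, h]`:
`(∑_t 𝔖({t₀, …, t_{k−1}})) / h^k → 1`.
Proof: with `y = ⌊log₁₆ h⌋` and `P = ∏_{p ≤ y} p ≤ 4^y ≤ √h`, `sum_singularSeries_bounds`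
squeezes the ratio between two functions of `y` alone that tend to `1`.
[cite: Gallagher1976, eq. 3] -/
theorem tendsto_sum_singularSeries_div_pow (k : ℕ) :
    Tendsto (fun h : ℕ =>
      (∑ t ∈ (Fintype.piFinset fun _ : Fin k => Icc 1 h).filter (fun t => Function.Injective t),
        singularSeries (tupleSet t)) / (h : ℝ) ^ k) atTop (𝓝 1) := by
  -- model lower and upper bounds as functions of the truncation level `y`
  set L : ℕ → ℝ := fun y => (1 - 2 * (k : ℝ) ^ 2 / y) *
    ((1 - (1 / 4 : ℝ) ^ y) ^ k - (k : ℝ) * k * ((y : ℝ) ^ k / 16 ^ y)) with hL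
  set U : ℕ → ℝ := fun y => Real.exp (4 * (k : ℝ) ^ 3 * Real.log 16 / Real.log y) *
    (1 + (1 / 4 : ℝ) ^ y) ^ k with hU
  have hq : Tendsto (fun y : ℕ => (1 / 4 : ℝ) ^ y) atTop (𝓝 0) :=
    tendsto_pow_atTop_nhds_zero_of_lt_one (by norm_num) (by norm_num)
  have hLlim : Tendsto L atTop (𝓝 1) := by
    have h1 : Tendsto (fun y : ℕ => 1 - 2 * (k : ℝ) ^ 2 / y) atTop (𝓝 (1 - 0)) :=
      tendsto_const_nhds.sub (tendsto_const_div_atTop_nhds_zero_nat _)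
    have h2 : Tendsto (fun y : ℕ => (1 - (1 / 4 : ℝ) ^ y) ^ k) atTop (𝓝 ((1 - 0) ^ k)) :=
      (tendsto_const_nhds.sub hq).pow k
    have h3 : Tendsto (fun y : ℕ => (k : ℝ) * k * ((y : ℝ) ^ k / 16 ^ y)) atTop
        (𝓝 ((k : ℝ) * k * 0)) :=
      (tendsto_pow_const_div_const_pow_of_one_lt k (by norm_num : (1 : ℝ) < 16)).const_mul _
    have := h1.mul (h2.sub h3)
    simp only [sub_zero, one_pow, mul_zero, one_mul] at this
    exact this
  have hUlim : Tendsto U atTop (𝓝 1) := by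
    have hlog : Tendsto (fun y : ℕ => Real.log y) atTop atTop :=
      Real.tendsto_log_atTop.comp tendsto_natCast_atTop_atTop
    have h1 : Tendsto (fun y : ℕ => 4 * (k : ℝ) ^ 3 * Real.log 16 / Real.log y) atTop (𝓝 0) :=
      tendsto_const_nhds.div_atTop hlog
    have h2 : Tendsto (fun y : ℕ => Real.exp (4 * (k : ℝ) ^ 3 * Real.log 16 / Real.log y)) atTop
        (𝓝 (Real.exp 0)) := (Real.continuous_exp.tendsto 0).comp h1
    have h3 : Tendsto (fun y : ℕ => (1 + (1 / 4 : ℝ) ^ y) ^ k) atTop (𝓝 ((1 + 0) ^ k)) :=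
      (tendsto_const_nhds.add hq).pow k
    have := h2.mul h3
    simp only [Real.exp_zero, add_zero, one_pow, mul_one] at this
    exact this
  have hy := tendsto_nat_log_sixteen
  refine tendsto_of_tendsto_of_tendsto_of_le_of_le' (hLlim.comp hy) (hUlim.comp hy) ?_ ?_
  · filter_upwards [hy.eventually_ge_atTop (2 * k * k + 2), eventually_ge_atTop 1] with h hyh hh1
    -- notation
    set y := Nat.log 16 h with hydef
    set P := primorial y with hPdef
    have hy2 : 2 ≤ y := by omega
    have hyk : 2 * k * k ≤ y := by omega
    obtain ⟨hlo, -⟩ := sum_singularSeries_bounds hy2 hyk h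
    have hh0 : (0 : ℝ) < h := by exact_mod_cast hh1
    have hhk : (0 : ℝ) < (h : ℝ) ^ k := by positivity
    have h16 : 16 ^ y ≤ h := Nat.pow_log_le_self 16 (by omega)
    have hP4 : P ≤ 4 ^ y := primorial_le_four_pow y
    have hPpos : 0 < P := primorial_pos y
    -- P / h ≤ (1/4)^y
    have hPh : (P : ℝ) / h ≤ (1 / 4 : ℝ) ^ y := by
      rw [div_le_iff₀ hh0]
      have e1 : (P : ℝ) ≤ (4 : ℝ) ^ y := by exact_mod_cast hP4
      have e2 : ((16 : ℕ) : ℝ) ^ y ≤ h := by exact_mod_cast h16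
      calc (P : ℝ) ≤ (4 : ℝ) ^ y := e1
        _ = (1 / 4 : ℝ) ^ y * ((16 : ℕ) : ℝ) ^ y := by
            rw [← mul_pow]; norm_num
        _ ≤ (1 / 4 : ℝ) ^ y * h := mul_le_mul_of_nonneg_left e2 (by positivity)
    have hq1 : (1 / 4 : ℝ) ^ y ≤ 1 := pow_le_one₀ (by norm_num) (by norm_num)
    -- (mP)/h ≥ 1 - (1/4)^y
    have hmP : 1 - (1 / 4 : ℝ) ^ y ≤ (((h / P) * P : ℕ) : ℝ) / h := by
      rw [le_div_iff₀ hh0]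
      have : h < h / P * P + P := Nat.lt_div_mul_add hPpos
      have e : (h : ℝ) < ((h / P * P : ℕ) : ℝ) + P := by exact_mod_cast this
      have e2 : (P : ℝ) ≤ (1 / 4 : ℝ) ^ y * h := by rwa [div_le_iff₀ hh0] at hPh
      nlinarith
    -- the `k² h^{k-1} y^k / h^k` term
    have hK : ((k * k * h ^ (k - 1) : ℕ) : ℝ) * (y : ℝ) ^ k / (h : ℝ) ^ k ≤
        (k : ℝ) * k * ((y : ℝ) ^ k / 16 ^ y) := by
      rcases Nat.eq_zero_or_pos k with hk0 | hkpos
      · subst hk0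
        simp
      have e1 : ((k * k * h ^ (k - 1) : ℕ) : ℝ) * (y : ℝ) ^ k / (h : ℝ) ^ k =
          (k : ℝ) * k * ((y : ℝ) ^ k / h) := by
        obtain ⟨k', rfl⟩ : ∃ k', k = k' + 1 := ⟨k - 1, by omega⟩
        simp only [Nat.add_sub_cancel]
        push_cast
        field_simp
        ring
      rw [e1]
      apply mul_le_mul_of_nonneg_left _ (by positivity)
      apply div_le_div_of_nonneg_left (by positivity) (by positivity)
      exact_mod_cast h16
    -- combine
    have hfac : 0 ≤ 1 - 2 * (k : ℝ) ^ 2 / y := by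
      have hy0 : (0 : ℝ) < y := by exact_mod_cast (show 0 < y by omega)
      rw [sub_nonneg, div_le_one hy0]
      have : ((2 * k * k : ℕ) : ℝ) ≤ y := by exact_mod_cast hyk
      push_cast at this
      nlinarith
    have step : L y ≤ (1 - 2 * (k : ℝ) ^ 2 / y) *
        ((((h / P) * P : ℕ) : ℝ) ^ k - ((k * k * h ^ (k - 1) : ℕ) : ℝ) * (y : ℝ) ^ k) /
          (h : ℝ) ^ k := by
      rw [hL]
      dsimp only
      conv_rhs => rw [mul_div_assoc]
      apply mul_le_mul_of_nonneg_left _ hfac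
      rw [sub_div, ← div_pow]
      apply sub_le_sub
      · exact pow_le_pow_left₀ (by linarith) hmP k
      · exact hK
    show (L ∘ fun h => Nat.log 16 h) h ≤ _
    simp only [Function.comp]
    rw [← hydef]
    refine step.trans ?_
    rw [div_le_div_iff_of_pos_right hhk]
    exact hlo
  · filter_upwards [hy.eventually_ge_atTop (2 * k * k + 2), eventually_ge_atTop 1] with h hyh hh1
    set y := Nat.log 16 h with hydef
    set P := primorial y with hPdef
    have hy2 : 2 ≤ y := by omega
    have hyk : 2 * k * k ≤ y := by omega
    obtain ⟨-, hhi⟩ := sum_singularSeries_bounds hy2 hyk h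
    have hh0 : (0 : ℝ) < h := by exact_mod_cast hh1
    have hhk : (0 : ℝ) < (h : ℝ) ^ k := by positivity
    have h16 : 16 ^ y ≤ h := Nat.pow_log_le_self 16 (by omega)
    have hlt16 : h < 16 ^ (y + 1) := Nat.lt_pow_succ_log_self (by norm_num) h
    have hP4 : P ≤ 4 ^ y := primorial_le_four_pow y
    have hPpos : 0 < P := primorial_pos y
    have hPh : (P : ℝ) / h ≤ (1 / 4 : ℝ) ^ y := by
      rw [div_le_iff₀ hh0]
      have e1 : (P : ℝ) ≤ (4 : ℝ) ^ y := by exact_mod_cast hP4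
      have e2 : ((16 : ℕ) : ℝ) ^ y ≤ h := by exact_mod_cast h16
      calc (P : ℝ) ≤ (4 : ℝ) ^ y := e1
        _ = (1 / 4 : ℝ) ^ y * ((16 : ℕ) : ℝ) ^ y := by
            rw [← mul_pow]; norm_num
        _ ≤ (1 / 4 : ℝ) ^ y * h := mul_le_mul_of_nonneg_left e2 (by positivity)
    -- ((m+1)P)/h ≤ 1 + (1/4)^y
    have hmP : (((h / P + 1) * P : ℕ) : ℝ) / h ≤ 1 + (1 / 4 : ℝ) ^ y := by
      rw [div_le_iff₀ hh0]
      have : (h / P + 1) * P ≤ h + P := by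
        rw [Nat.add_mul, one_mul]
        exact Nat.add_le_add_right (Nat.div_mul_le_self h P) P
      have e : (((h / P + 1) * P : ℕ) : ℝ) ≤ h + P := by exact_mod_cast this
      have e2 : (P : ℝ) ≤ (1 / 4 : ℝ) ^ y * h := by rwa [div_le_iff₀ hh0] at hPh
      nlinarith
    -- the exponent
    have hy0 : (0 : ℝ) < y := by exact_mod_cast (show 0 < y by omega)
    have hlogy : 0 < Real.log y := Real.log_pos (by exact_mod_cast (show 1 < y by omega))
    have hlogh : Real.log h ≤ (y + 1) * Real.log 16 := by
      have : Real.log h ≤ ((y + 1 : ℕ) : ℝ) * Real.log 16 := by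
        rw [← Real.log_pow]
        apply Real.log_le_log hh0
        exact_mod_cast hlt16.le
      push_cast at this
      exact this
    have hexp : 2 * k / y * ((k : ℝ) ^ 2 * (Real.log h / Real.log y)) ≤
        4 * (k : ℝ) ^ 3 * Real.log 16 / Real.log y := by
      have hlogh0 : 0 ≤ Real.log h := Real.log_natCast_nonneg h
      have e1 : Real.log h / Real.log y ≤ (y + 1) * Real.log 16 / Real.log y :=
        div_le_div_of_nonneg_right hlogh hlogy.le
      have hy1 : (1 : ℝ) ≤ y := by exact_mod_cast (show 1 ≤ y by omega)
      calc 2 * k / y * ((k : ℝ) ^ 2 * (Real.log h / Real.log y))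
          ≤ 2 * k / y * ((k : ℝ) ^ 2 * ((y + 1) * Real.log 16 / Real.log y)) := by
            apply mul_le_mul_of_nonneg_left _ (by positivity)
            exact mul_le_mul_of_nonneg_left e1 (by positivity)
        _ = 2 * (k : ℝ) ^ 3 * Real.log 16 / Real.log y * ((y + 1) / y) := by
            field_simp
        _ ≤ 2 * (k : ℝ) ^ 3 * Real.log 16 / Real.log y * 2 := by
            apply mul_le_mul_of_nonneg_left _ (by positivity)
            rw [div_le_iff₀ hy0]
            linarith
        _ = 4 * (k : ℝ) ^ 3 * Real.log 16 / Real.log y := by ring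
    have step : Real.exp (2 * k / y * ((k : ℝ) ^ 2 * (Real.log h / Real.log y))) *
        (((h / P + 1) * P : ℕ) : ℝ) ^ k / (h : ℝ) ^ k ≤ U y := by
      rw [hU]
      dsimp only
      conv_lhs => rw [mul_div_assoc, ← div_pow]
      apply mul_le_mul (Real.exp_le_exp.2 hexp) _ (by positivity) (Real.exp_pos _).le
      exact pow_le_pow_left₀ (by positivity) hmP k
    show _ ≤ (U ∘ fun h => Nat.log 16 h) h
    simp only [Function.comp]
    rw [← hydef]
    refine le_trans ?_ step
    rw [div_le_div_iff_of_pos_right hhk]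
    exact hhi

end Literature.NumberTheory.Sieve.Gallagher
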